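import Summits.AtomisticToContinuum.BoseEinsteinCondensation.Theorems.BECThomsonPrincipleDefs
import HarnessLib

/-!
# Route `BECThomsonPrinciple`, crux `FibreConductance` (stmt-AtomisticToContinuum-9480):
# vocabulary and stub statements of the line `tagged-path-harnack-cage-moments`

Route-posited objects (D-0016 `<Route>Defs`-type file; precedent and base layer
`BECThomsonPrincipleDefs.lean`, whose vocabulary `fibreW`, `fibrePsi`, `fibreBeta`, `fibreDensCost`,
`HasWeakDiv`, `fibreCost`, `LowDensityWindow` and statements `GradientComparability`,
`BetaCorrectorBound`, `ShellOccupation`, `TransportReduction`, `ParsevalShellBound`,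
`gradientCorrectorBound_of` are re-used verbatim). NOTHING IS ASSERTED here: every `def … : Prop`
below is a *statement* (a stub signature or an intermediate goal) of the checked skeleton
`Cruxes/FibreConductance/Lines/tagged_path_harnack_cage_moments.lean` as reshaped by the gen-1 line
lead (same composition idea; `stub_fibreSpine` discharged by the landed `stub_transport` /
`stub_parsevalShell`; `stub_betaChannel` split into `stub_flatteningOfMoments` and `stub_betaHolder`),
consumed only as the type of a stub theorem or as a hypothesis of the sorry-free composition
`cage_compose` proved at the end. The stub theorems land one per file under
`Theorems/BECThomsonPrincipleFibreConductance<Stub>.lean` (`--supports` the crux item).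

**The crux** (`Theses/BECThomsonPrinciple.lean`, `def FibreConductance`): for bounded repulsive
finite-range `v`, every window parameter `M`, every exact zero-free `C¹` minimiser `Φ` on the torus and
every window mode `k = 2πn/L`, `2π‖n‖/L ≤ M√ρ`: ONE flow `J` in the `x₀`-fibre with weak divergence the
fibre-neutral charge `q = L^{-3/2}(e^{ik·x₀}ψ − βψ²)` and cost `∫|J|²W/ψ² ≤ C L²/‖n‖²`.

**The line.** Transport along the conditional amplitude (landed: `TransportReduction`) leaves two
correctors. The gradient corrector = `GradientComparability ∧ FlatBound` (landed glue
`gradientCorrectorBound_of`; `FlatBound` from `ShellOccupation` by the landed `ParsevalShellBound`);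
here `GradientComparability` is to come from Born-centred ball-ratio moments of the exact minimiser
(`BallHarnackMoment`, output of the Cameron–Martin lever `ShiftHarnack` fed by the quantum Ruelle
input `LocalNumberExpMoments`) together with uniform-location two-sided moments of the normalised
conditional density (`ConditionalDensityMoments`) — `GradientFromHarnack`. The β-corrector is taken by
HÖLDER `(3/2, 3)` (`BetaHolder`), which needs density flattening only at the k-blind Poincaré scale,
`∫ W·D³ ≤ K L⁹` (`DensityFlatteningCubic`), and that follows from `ConditionalDensityMoments`
deterministically by the iterated-primitive flow (`FlatteningOfMoments`). Composition (`cage_compose`):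
`fun t ps ℓ h c g f b s => t (gradientCorrectorBound_of (g (h ℓ) ℓ c) (ps s)) (b (f c) s)`.

References: the line card `Cruxes/FibreConductance/Lines/tagged-path-harnack-cage-moments.md`;
R. Lyons, Y. Peres, *Probability on Trees and Networks* (2016) Ch. 2 (Thomson's principle);
M. Arnaudon, A. Thalmaier, F.-Y. Wang, Bull. Sci. Math. 130 (2006) 223 (Harnack by change of
measure); Y. M. Park, Commun. Math. Phys. 94 (1984) 1 (exponentials of local number operators);
LSSY2005 §1.2 (1.17)–(1.18) (occupations).
-/

noncomputable section

namespace Summit.AtomisticToContinuum.BoseEinsteinCondensation.Cruxes.FibreConductance.TaggedPathHarnack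

open MeasureTheory
open scoped ENNReal Classical
open Literature.MathematicalPhysics.QuantumManyBody.BoseGas
open Summit.AtomisticToContinuum.BoseEinsteinCondensation.Theses.BECThomsonPrinciple (FibreConductance)
open Summit.AtomisticToContinuum.BoseEinsteinCondensation.Cruxes.FibreConductance.ParsevalShellBootstrap
  (fibreW fibrePsi fibreBeta fibreDensCost HasWeakDiv fibreCost LowDensityWindow GradientComparability
    GradientCorrectorBound BetaCorrectorBound FlatBound TransportReduction ParsevalShellBound
    ShellOccupation gradientCorrectorBound_of)

variable {m : ℕ} {L : ℝ}

/-! ## §0 Vocabulary of the line -/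

/-- TWO-SIDED BALL RATIO (local Harnack quotient of the landscape seen by the tagged particle):
`R_r(X) = sup_{|y − x₀| ≤ r} |Φ(y, X̂)| / inf_{|y − x₀| ≤ r} |Φ(y, X̂)|` — the oscillation of the
exact minimiser in the ONE variable `x₀` over the closed ball of radius `r` about the tagged
particle, bath frozen (`≥ 1`; `= 1` for the constant state; also `sup ψ / inf ψ` since `W` is
fibre-constant). `Φ` is continuous, periodic and zero-free, so the `sup` is finite and the `inf`
positive. [folklore] -/
def ballRatio (r : ℝ) (Φ : PeriodicTrialState (m + 1) L) (X : Config (m + 1)) : ℝ :=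
  (⨆ y : ↥(Metric.closedBall (X 0) r), ‖Φ.ψ (Function.update X 0 (y : Space))‖) /
    (⨅ y : ↥(Metric.closedBall (X 0) r), ‖Φ.ψ (Function.update X 0 (y : Space))‖)

/-- `x` and `y` are within torus distance `R` on `ℝ³/Lℤ³`. [folklore] -/
def TorusNear (L R : ℝ) (x y : Space) : Prop :=
  ∃ n : Fin 3 → ℤ, ‖x - y - latticeVec L n‖ < R

/-- LOCAL NUMBER at a fixed location: the number of particles of `X` within torus distance `R` of
the point `x`. [folklore] -/
def locNumber (L R : ℝ) (x : Space) (X : Config (m + 1)) : ℕ :=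
  (Finset.univ.filter fun j : Fin (m + 1) => TorusNear L R x (X j)).card

/-- TAGGED LOCAL NUMBER: the number of bath particles `j ≠ 0` within torus distance `R` of the
tagged particle `x₀` (for `v ≤ B` supported in `[0, R₀]` the interaction felt by a ghost point within
`r` of `x₀` is `≤ B · tagNumber (R₀ + r)`). [folklore] -/
def tagNumber (L R : ℝ) (X : Config (m + 1)) : ℕ :=
  ((Finset.univ.erase 0).filter fun j : Fin (m + 1) => TorusNear L R (X 0) (X j)).card

/-! ## §1 The bath-law inputs, the lever's output, and the Poincaré-scale flattening goal -/

/-- **Statement of `stub_localNumberTail` — LOCAL NUMBER EXPONENTIAL MOMENTS (L/XL; open input;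
uses (H1)).** For bounded repulsive finite-range `v`, every `Λ ≥ 0` and every radius `R > 0` there
are `ρ₀, C, N₀` such that for `N ≥ N₀` bosons at density `≤ ρ₀` and every exact zero-free minimiser
`Φ`, under the Born law `|Φ|²dX`: (i) at every FIXED location `x`, `E e^{Λ·#{j : |X_j − x|_T < R}} ≤ C`;
(ii) around the TAGGED particle, `E e^{Λ·#{j ≠ 0 : |X_j − X_0|_T < R}} ≤ C`. This is the
exponential-moment (Poisson-domination) form of the RUELLE BOUND `ρ^{(K)} ≤ (ξ₀ρ)^K` for the
`K`-point functions of the quantum GROUND STATE, uniformly in `N, L` at low density; the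
positive-temperature grand-canonical analogue is Park's bound on exponentials of local number
operators for superstable interactions, whose `β → ∞` / canonical uniformity is not in print. Free
gas: minimisers are constants, the count is binomial and `E e^{Λn} ≤ exp((e^Λ − 1)ρ₀|B_R|)`. `N₀`
after `R` forces `L ≥ 4R`. Why it might fail: anomalous clustering of the ground state of a
PENETRABLE (bounded) potential — cluster phases exist at HIGH density; the claim is only
`ρ ≤ ρ₀(v, Λ, R)`; false for non-minimisers concentrated on clusters (so (H1) is used).
(Refs: Ruelle1970 superstable estimates; Park1984 doi:10.1007/bf01212347; Park1985
doi:10.1007/bf01010537.) -/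
def LocalNumberExpMoments : Prop :=
  ∀ v : ℝ → ℝ≥0∞, IsRepulsiveFiniteRange v → (∃ B : ℝ, ∀ r, v r ≤ ENNReal.ofReal B) →
    ∀ Λ R : ℝ, 0 ≤ Λ → 0 < R → ∃ ρ₀ C : ℝ, 0 < ρ₀ ∧ 0 < C ∧ ∃ N₀ : ℕ, ∀ m : ℕ, N₀ ≤ m + 1 →
      ∀ L : ℝ, 0 < L → ((m + 1 : ℕ) : ℝ) ≤ ρ₀ * L ^ 3 →
        ∀ Φ : PeriodicTrialState (m + 1) L,
          periodicEnergy v Φ = periodicGroundStateEnergy v (m + 1) L → (∀ X, Φ.ψ X ≠ 0) →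
            (∀ x : Space,
              ∫⁻ X in cellN (m + 1) L,
                  ENNReal.ofReal (‖Φ.ψ X‖ ^ 2 * Real.exp (Λ * (locNumber L R x X : ℝ))) ≤
                ENNReal.ofReal C) ∧
            ∫⁻ X in cellN (m + 1) L,
                ENNReal.ofReal (‖Φ.ψ X‖ ^ 2 * Real.exp (Λ * (tagNumber L R X : ℝ))) ≤
              ENNReal.ofReal C

/-- **Output of the lever, consumed by `stub_gradientFromHarnack` — BALL HARNACK MOMENTS
(Born-centred two-sided one-variable regularity of the exact minimiser).** For bounded repulsive
finite-range `v`, every radius `r > 0` and every order `p` there are `ρ₀, C, N₀` such that for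
`N ≥ N₀` bosons at density `≤ ρ₀` and every exact zero-free minimiser `Φ`,
`E_{|Φ|²}[ (sup_{B(x₀,r)}|Φ(·,X̂)| / inf_{B(x₀,r)}|Φ(·,X̂)|)^p ] ≤ C` — uniformly in `N` and `L`.
Free value `1`. It is FALSE without (H1) (slab cage of Disproof §G2: ratio `1/σ` on the
Born-visible neighbourhood of a barrier, `σ` free) and says nothing at UNIFORM locations (holes of
the conditional law are Born-invisible: see `ConditionalDensityMoments`). (Refs: Wang1997
doi:10.1007/s004400050137; ArnaudonThalmaierWang2006 doi:10.1016/j.bulsci.2005.10.001.) -/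
def BallHarnackMoment : Prop :=
  ∀ v : ℝ → ℝ≥0∞, IsRepulsiveFiniteRange v → (∃ B : ℝ, ∀ r, v r ≤ ENNReal.ofReal B) →
    ∀ r : ℝ, 0 < r → ∀ p : ℕ, ∃ ρ₀ C : ℝ, 0 < ρ₀ ∧ 0 < C ∧ ∃ N₀ : ℕ, ∀ m : ℕ, N₀ ≤ m + 1 →
      ∀ L : ℝ, 0 < L → ((m + 1 : ℕ) : ℝ) ≤ ρ₀ * L ^ 3 →
        ∀ Φ : PeriodicTrialState (m + 1) L,
          periodicEnergy v Φ = periodicGroundStateEnergy v (m + 1) L → (∀ X, Φ.ψ X ≠ 0) →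
            ∫⁻ X in cellN (m + 1) L, ENNReal.ofReal (‖Φ.ψ X‖ ^ 2 * ballRatio r Φ X ^ p) ≤
              ENNReal.ofReal C

/-- **Statement of `stub_conditionalDensityMoments` — CONDITIONAL DENSITY MOMENTS (L/XL; open; the
cage / fluidity half of the crux in its barest, flow-free form; uses (H1)).** For bounded repulsive
finite-range `v` and every order `p` there are `ρ₀, C, N₀` such that for `N ≥ N₀` bosons at density
`≤ ρ₀` and every exact zero-free minimiser, the normalised conditional density `g = L³ψ²` of one
particle given the others has bounded TWO-SIDED moments at UNIFORM locations in bath average: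
`E_W[ ⨍_cell (g^p + g^{-p}) dy ] ≤ C`, written `∫_{cellN} W·(g^p + (g⁻¹)^p) ≤ C L³` (`∫_{cellN} W = L³`).
`g^{-p}` at uniform `y` charges HOLES of the conditional law (cages, dense clusters), weighted by
their Lebesgue — not Born — volume; `g^{+p}` charges SELF-TRAPPING of the tagged particle. Free gas:
`g ≡ 1`, value `2L³` (`C ≥ 2`). Without (H1) it is false (slab cage: `⨍ g^{-p} ≍ σ^{-2p}/2`, `σ`
free). Why it might fail: a heavy tail of cage depth at fixed wall content, or percolation of holes
at the densities allowed — then only `p ≤ p₀(ρ₀)` holds (the β-channel uses `p = 12`).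
(Refs: ReattoChester1967 doi:10.1103/PhysRev.155.88; Disproof §G2.) -/
def ConditionalDensityMoments : Prop :=
  ∀ v : ℝ → ℝ≥0∞, IsRepulsiveFiniteRange v → (∃ B : ℝ, ∀ r, v r ≤ ENNReal.ofReal B) →
    ∀ p : ℕ, ∃ ρ₀ C : ℝ, 0 < ρ₀ ∧ 0 < C ∧ ∃ N₀ : ℕ, ∀ m : ℕ, N₀ ≤ m + 1 →
      ∀ L : ℝ, 0 < L → ((m + 1 : ℕ) : ℝ) ≤ ρ₀ * L ^ 3 →
        ∀ Φ : PeriodicTrialState (m + 1) L,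
          periodicEnergy v Φ = periodicGroundStateEnergy v (m + 1) L → (∀ X, Φ.ψ X ≠ 0) →
            ∫⁻ X in cellN (m + 1) L,
                ENNReal.ofReal (fibreW Φ X *
                  ((L ^ 3 * fibrePsi Φ X ^ 2) ^ p + ((L ^ 3 * fibrePsi Φ X ^ 2)⁻¹) ^ p)) ≤
              ENNReal.ofReal (C * L ^ 3)

/-- DENSITY FLATTENING AT THE POINCARÉ SCALE, CUBIC MOMENT (intermediate goal of the β-channel;
`k`-free): exact zero-free minimisers at density `≤ ρ₀` admit a measurable fibre flow `J_d` with weak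
divergence `ψ² − L⁻³` whose fibre cost `D(X̂) = ∫_cell|J_d|²/ψ²dy` (`fibreDensCost`) has
`E_W[D³] ≤ K L⁶`, written `∫_{cellN} W·D³ ≤ K L⁹`. Compared with the base line's
`DensityFlattening` (`E_W[D²] ≤ KL²`, i.e. `D = O(L)`), this tolerates `D = O(L²)` — the k-blind
Poincaré scale of the torus — and is therefore a pure landscape statement (see
`FlatteningOfMoments`). (Intermediate goal; a statement, not a cited fact.) -/
def DensityFlatteningCubic : Prop :=
  ∀ v : ℝ → ℝ≥0∞, IsRepulsiveFiniteRange v → (∃ B : ℝ, ∀ r, v r ≤ ENNReal.ofReal B) →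
    ∃ ρ₀ K : ℝ, 0 < ρ₀ ∧ 0 < K ∧ ∃ N₀ : ℕ, ∀ m : ℕ, N₀ ≤ m + 1 →
      ∀ L : ℝ, 0 < L → ((m + 1 : ℕ) : ℝ) ≤ ρ₀ * L ^ 3 →
        ∀ Φ : PeriodicTrialState (m + 1) L,
          periodicEnergy v Φ = periodicGroundStateEnergy v (m + 1) L → (∀ X, Φ.ψ X ≠ 0) →
            ∃ J : Config (m + 1) → (Fin 3 → ℂ), Measurable J ∧
              HasWeakDiv L J (fun X => ((fibrePsi Φ X ^ 2 - (L ^ 3)⁻¹ : ℝ) : ℂ)) ∧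
                ∫⁻ X in cellN (m + 1) L, ENNReal.ofReal (fibreW Φ X) * fibreDensCost Φ J X ^ 3 ≤
                  ENNReal.ofReal (K * L ^ 9)

/-! ## §2 The statements of the registered stubs -/

/-- **Statement of `stub_shiftHarnack` — THE LEVER (L on paper, XL in Lean; uses (H1)
essentially).** `LocalNumberExpMoments → BallHarnackMoment`. Proof (units `ħ = 2m = 1`, `T := r²`):
(1) the modulus of the exact zero-free minimiser is the torus Feynman–Kac ground state
(`IsPeriodicGroundStateFK v L |Φ|`: eigen-relation pointwise) and the Cameron–Martin tilt of the
TAGGED world-line by the linear shift `h(s) = (1 − s/T)z`, vanishing at the fixed horizon, gives for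
every `X` and `|z| ≤ r`: `Ψ₀(X+ze₀)/Ψ₀(X) = E^{gs}_X[Z_T(z)e^{−∫₀ᵀD(z)}]`,
`Z_T(z) = e^{z·ΔB⁰_T/(2T) − |z|²/(4T)}`, `−U₀ ≤ D(z) ≤ U₀^{(r)} ≤ B·tagNumber(R₀+r)` (all bath–bath
terms and `E₀` cancel; `N` never enters); (2) `sup_z` / `inf_z` INSIDE the expectation and Jensen;
(3) Born moments through the STATIONARY ground-state path law (one-time marginals are Born by the
symmetry of `periodicFKSemigroup`); (4) Cauchy–Schwarz separates displacement from interaction: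
`E^{stat}e^{c·ΔB⁰_T} ≤ e^{|c|²T}` (numerical range of the boosted Hamiltonian, universal), and Jensen
in time + stationarity reduce the interaction factor to `LocalNumberExpMoments` (ii) with
`Λ = 4pr²B`, `R = R₀ + r`. Constants `e^{O(p²)} ×` that moment, free of `N, L`; at `v = 0` every step
is an equality up to `8e^{12p²}`. Why it might fail: only in formalisation (identification of the
variational minimiser with the FK ground state; Cameron–Martin for a linear tagged drift).
(Refs: ArnaudonThalmaierWang2006 doi:10.1016/j.bulsci.2005.10.001; Wang1997
doi:10.1007/s004400050137; ChungZhao1995 §3.2; KipnisVaradhan1986.) -/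
def ShiftHarnack : Prop :=
  LocalNumberExpMoments → BallHarnackMoment

/-- **Statement of `stub_gradientFromHarnack` — THE OSCILLATING-CHARGE LANDSCAPE STEP (L/XL; uses
(H1) through its inputs).** `BallHarnackMoment → LocalNumberExpMoments → ConditionalDensityMoments →
GradientComparability` (the base line's landscape statement for the gradient charge
`ε♭ = L^{-3/2}[e^{ik·y}(k·∇ψ)/(i|k|²) + β/L³]`: a measurable corrector with WEIGHTED cost
`≤ K·∫W·flatEnergy + K L²/‖n‖²`). Intended proof (two scales, fixed cube side `ℓ₀ = ℓ₀(v)`):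
(a) LOCAL NEUTRALISATION WITHOUT GRADIENTS (`∫_Q e^{ik·y}k·∇ψ = ∮_{∂Q}e^{ik·y}ψ k·ν − i|k|²∫_Qe^{ik·y}ψ`:
cube charges and local `H⁻¹(Q)` norms of `ε♭` are bounded by the oscillation `ψ_min(R_Q − 1)`, so the
weighted local cost is depth-independent; uniform-location ratio moments = Born ratio moments ×
inverse-density moments by `E_W⨍F = E_Born[g^{-1}F]` and Cauchy–Schwarz); (b) COARSE FLOW of the
cube charges = flat coarse flow + Grimmett–Kesten–Zhang detours around the sparse bad cubes
`{⨍_Q g < 1/S}` (density `≤ S^{-p}C_p` by `ConditionalDensityMoments`, separation from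
`LocalNumberExpMoments` (i)); flux tubes pay the deterministic `S`, whence only `E_W[flatEnergy]` is
consumed. Why it might fail: correlation between flat fluxes and hole locations (the charge `∝ ∇ψ`
lives on cage walls) needs either `L^{1+δ}` moments of the local flat corrector energy or a
decorrelation of holes inherited from particle statistics; false without (H1) (slab: `s = e^{2K}` on
a spanning wall). (Refs: GrimmettKestenZhang1993 doi:10.1007/bf01195881; Barlow2004; LSSY2005
Thm. 2.2 (`∫W|∇₀ψ|² ≤ T/N`, PROVED `LSSY2005_upperBound_periodic_holds`).) -/
def GradientFromHarnack : Prop :=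
  BallHarnackMoment → LocalNumberExpMoments → ConditionalDensityMoments → GradientComparability

/-- **Statement of `stub_flatteningOfMoments` — FLATTENING AT THE POINCARÉ SCALE FROM MOMENTS
(M/L; deterministic torus calculus given its input).** `ConditionalDensityMoments →
DensityFlatteningCubic`. Proof: on each fibre let `σ = ψ² − L⁻³` (`C¹`, periodic, `∫_cell σ = 0`)
and take the ITERATED-PRIMITIVE flow `J₁(y) = ∫₀^{y₁}(σ − ⟨σ⟩₁)(t,y₂,y₃)dt`,
`J₂(y) = ∫₀^{y₂}(⟨σ⟩₁ − ⟨σ⟩₁₂)(t,y₃)dt`, `J₃(y) = ∫₀^{y₃}⟨σ⟩₁₂(t)dt` (`⟨·⟩₁`, `⟨·⟩₁₂` = line and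
plane averages; `⟨σ⟩₁₂₃ = 0`), which is periodic, `C¹` along each axis with
`∂₁J₁ + ∂₂J₂ + ∂₃J₃ = σ` (weak divergence by parts in one variable), measurable (continuous) in the
configuration, and satisfies `|J_l| ≤ 2L⁻²(⟨g⟩ + 1)` with `g = L³ψ²` and `⟨g⟩` the corresponding
line/plane/cell average. Hence `D ≤ 4L⁻¹∫_cell h·g⁻¹dy`, `h = (⟨g⟩₁+1)² + (⟨g⟩₁₂+1)² + 4`,
`D³ ≤ 64 (∫_cell h³)(∫_cell g⁻³)` (Cauchy–Schwarz and Jensen `(∫_cell f)^{3/2} ≤ L^{3/2}∫_cell f^{3/2}`),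
`∫_{cell^m} W·D³ ≤ 64 L³ (∫W∫h⁶)^{1/2}(∫W∫g⁻⁶)^{1/2}` (Cauchy–Schwarz in the bath), and Jensen on
line/plane averages (`∫_cell ⟨g⟩^{12} ≤ ∫_cell g^{12}`) reduces everything to
`ConditionalDensityMoments` at `p = 12`: `∫_{cellN} W·D³ ≤ K L⁹`. No Green kernel, no Sobolev
inequality. Free gas: `σ = 0`, `J = 0`. Why it might fail: it does not beyond bookkeeping (Fubini on
the cell as a product of three intervals; parametric interval integrals). (Refs: LyonsPeres2016 Ch. 2
(any admissible flow bounds the resistance); Folland, Real Analysis, §2.5 (iterated integrals).) -/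
def FlatteningOfMoments : Prop :=
  ConditionalDensityMoments → DensityFlatteningCubic

/-- **Statement of `stub_betaHolder` — THE β-CHANNEL BY HÖLDER (M; deterministic given its
inputs; template = the landed `stub_betaCorrector` with Cauchy–Schwarz replaced by Hölder).**
`DensityFlatteningCubic → ShellOccupation → BetaCorrectorBound`: `J♮ := L^{-3/2}β·J_d` has weak
divergence `ε♮ = L^{-3/2}β(ψ² − L⁻³)` (`bc_hasWeakDiv_beta_mul`: `β` is `C¹`, bath-periodic,
fibre-constant) and cost `L⁻³∫(|β|²/L³)·W·D ≤ L⁻³(∫W|β|²/L³)^{2/3}(∫W·D³)^{1/3}` (HÖLDER `3/2–3` in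
the bath, using `|β|²/L³ ≤ 1` so that `(|β|²/L³)^{3/2} ≤ |β|²/L³`), where
`∫W|β|²/L³ = L³·n_{−n}(|Φ|)/N ≤ L³K/(‖n‖²p₁)` (`lintegral_fibreW_mul_norm_sq_cellFourierCoeff` and the
occupation input at the resonant mode `p = −n`, radius `p₁ = min(θ√ρL/2π, ‖n‖/2)`) and
`∫W·D³ ≤ K_dL⁹`: cost `≤ K^{2/3}K_d^{1/3}L²/(‖n‖^{4/3}p₁^{2/3}) ≤ C L²/‖n‖²` iff
`K²K_d‖n‖² ≤ C³p₁²`, true in both cases of `p₁` with `C³ = 4K²K_d + K²K_dM²/θ²` because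
`‖n‖ ≤ M√ρL/2π` in the window — no `L₀` needed. Free gas: `ε♮ = 0`, `J♮ = 0`. Why it might fail:
it does not beyond bookkeeping. (Refs: LSSY2005 §1.2 (1.17); LyonsPeres2016 Ch. 2.) -/
def BetaHolder : Prop :=
  DensityFlatteningCubic → ShellOccupation → BetaCorrectorBound

/-! ### Audit names of the stub statements

`Goal.stub_x` abbreviates the statement of the registered stub `stub_x`, so that the skeleton audit
reads the hypotheses of `FibreConductance_of` as exactly the seven declared stubs. -/

namespace Goal

/-- Statement of `stub_localNumberTail`. -/
abbrev stub_localNumberTail : Prop := LocalNumberExpMoments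
/-- Statement of `stub_shiftHarnack`. -/
abbrev stub_shiftHarnack : Prop := ShiftHarnack
/-- Statement of `stub_conditionalDensityMoments`. -/
abbrev stub_conditionalDensityMoments : Prop := ConditionalDensityMoments
/-- Statement of `stub_gradientFromHarnack`. -/
abbrev stub_gradientFromHarnack : Prop := GradientFromHarnack
/-- Statement of `stub_flatteningOfMoments`. -/
abbrev stub_flatteningOfMoments : Prop := FlatteningOfMoments
/-- Statement of `stub_betaHolder`. -/
abbrev stub_betaHolder : Prop := BetaHolder
/-- Statement of `stub_shellOccupation` (verbatim the base line's `ShellOccupation`). -/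
abbrev stub_shellOccupation : Prop := ShellOccupation
/-- Statement of the bookkeeping composition `cage_compose`: the landed transport reduction and
Parseval–shell bound together with the seven stub statements imply the crux `FibreConductance` BY
NAME. -/
abbrev cage_compose : Prop :=
  TransportReduction → ParsevalShellBound → stub_localNumberTail → stub_shiftHarnack →
    stub_conditionalDensityMoments → stub_gradientFromHarnack → stub_flatteningOfMoments →
      stub_betaHolder → stub_shellOccupation → FibreConductance

end Goal

/-! ## §3 The composition (proved) and sanity lemmas -/

/-- **The composition, proved**: transport reduction `t`, Parseval–shell `ps` and the seven stub
statements give the crux — the ratio moments (lever `h` fed by `ℓ`) and the conditional-density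
moments `c` give the gradient corrector through `g` and the landed glue `gradientCorrectorBound_of`
with the flat bound `ps s`; the β-corrector is `b (f c) s`. [folklore] -/
theorem cage_compose : Goal.cage_compose :=
  fun t ps ℓ h c g f b s => t (gradientCorrectorBound_of (g (h ℓ) ℓ c) (ps s)) (b (f c) s)

/-- The ball ratio of the constant state is `1` wherever the ball is inhabited (`0 ≤ r`): the free
value of `BallHarnackMoment`. [folklore] -/
theorem ballRatio_const {c : ℂ} (hc : c ≠ 0) {r : ℝ} (hr : 0 ≤ r) (Φ : PeriodicTrialState (m + 1) L)
    (hΦ : ∀ X, Φ.ψ X = c) (X : Config (m + 1)) : ballRatio r Φ X = 1 := by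
  have hne : Nonempty ↥(Metric.closedBall (X 0) r) := ⟨⟨X 0, Metric.mem_closedBall_self hr⟩⟩
  simp [ballRatio, hΦ, ciSup_const, ciInf_const, norm_ne_zero_iff.mpr hc]

/-- The tagged local number never exceeds the number of bath particles `m` (so every exponential
moment in `LocalNumberExpMoments` is finite at fixed `N`; the content is uniformity). [folklore] -/
theorem tagNumber_le (L R : ℝ) (X : Config (m + 1)) : tagNumber L R X ≤ m := by
  unfold tagNumber
  calc ((Finset.univ.erase 0).filter fun j : Fin (m + 1) => TorusNear L R (X 0) (X j)).card
      ≤ (Finset.univ.erase (0 : Fin (m + 1))).card := Finset.card_filter_le _ _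
    _ = m := by simp [Finset.card_erase_of_mem]

/-- The local number never exceeds the number of particles `m + 1`. [folklore] -/
theorem locNumber_le (L R : ℝ) (x : Space) (X : Config (m + 1)) : locNumber L R x X ≤ m + 1 := by
  unfold locNumber
  calc (Finset.univ.filter fun j : Fin (m + 1) => TorusNear L R x (X j)).card
      ≤ (Finset.univ : Finset (Fin (m + 1))).card := Finset.card_filter_le _ _
    _ = m + 1 := by simp

end Summit.AtomisticToContinuum.BoseEinsteinCondensation.Cruxes.FibreConductance.TaggedPathHarnack

end
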